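import Mathlib
import Summits.PneNP.PneNP.Theorems.ClusUniversalCertificateCoordDefs

/-!
# Route ClusUniversalCertificate — the direct-sum conjecture (⊕): objects (crux `UniversalCertAll`, stmt-PneNP-19683)

Rung F-N1, cell pnp-ideate.  Planner p1 g7's ROUND-7 §6g / `HOME/pnp-ideate-p1/lines/SketchOPlus.lean` and
`lines/oplus-line-UNREGISTERED.lean` (namespace `…Theorems.ClusCoordOPlus`) VERBATIM: `IsDomPot`, `dplus`, `OPlus`,
`OPlusAll`, `qpot`, `QPotDom`, `OPlusImpliesUC`, `Lift1`; plus ONE prover's helper object `bpot` (the block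
potential `⊕_j qpot (bsize j)` of a block map, in terms of which `UCMix blk Y` reads `dsum Y ≤ Σ_{y∈Y} bpot blk y`).

THE CONJECTURE (⊕) (p1): a potential `p : 𝔽₂^M → ℚ` is DOMINATING if `dsum S ≤ Σ_{x∈S} p x` for every
`S ⊆ 𝔽₂^M` (`dsum S = Σ_{x∈S} dim_S x`, the sum of the dimensions of the largest flats inside `S` through its
points); (⊕) says dominating potentials are closed under direct sum along `𝔽₂^(a+b) = 𝔽₂^a × 𝔽₂^b`.  The one-block
potential `qpot b = (b − 1) + 2^b·[c = 0]` is dominating (`QPotDom`, two lines), and the mixed block certificate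
`UCMix` is domination of the direct sum of the `qpot (bsize j)`; so `(⊕) ⇒ UCMixDim M` for every `M`
(`OPlusImpliesUC`, an induction on the number of blocks — proved in `ClusUniversalCertificateOPlusImpliesUC`).

HONEST FRAMING: objects only; (⊕) is an OPEN conjecture of p1's (censuses running at the time of writing), not
asserted here; FRONTIER rung F-N1 — nothing here bears on P vs NP.
-/

set_option linter.dupNamespace false -- `Summit.PneNP.PneNP.…`: summit = sub-problem name (D-0017 single-conjunct layout)

namespace Summit.PneNP.PneNP.Theorems.ClusCoordOPlus

open Finset Summit.PneNP.PneNP.Theorems.ClusCoord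

/-- `p` is a DOMINATING POTENTIAL on `𝔽₂^M`: `dsum S ≤ Σ_{x∈S} p x` for every `S ⊆ 𝔽₂^M`. (p1 §6g, verbatim) -/
def IsDomPot (M : ℕ) (p : (Fin M → ZMod 2) → ℚ) : Prop :=
  ∀ S : Finset (Fin M → ZMod 2), ((dsum M S : ℤ) : ℚ) ≤ ∑ x ∈ S, p x

/-- Direct sum of potentials along `Fin (a + b) = Fin a ⊕ Fin b` (first `a` coordinates via `Fin.castAdd`, last `b`
via `Fin.natAdd`). (p1 §6g, verbatim) -/
def dplus {a b : ℕ} (p : (Fin a → ZMod 2) → ℚ) (q : (Fin b → ZMod 2) → ℚ) :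
    (Fin (a + b) → ZMod 2) → ℚ :=
  fun z => p (fun i => z (Fin.castAdd b i)) + q (fun j => z (Fin.natAdd a j))

/-- Conjecture (⊕) for ONE split `a + b`: direct sums of dominating potentials are dominating. (p1 §6g, verbatim) -/
def OPlus (a b : ℕ) : Prop :=
  ∀ p q, IsDomPot a p → IsDomPot b q → IsDomPot (a + b) (dplus p q)

/-- Conjecture (⊕): `OPlus a b` for all `a, b`. (p1 §6g, verbatim; OPEN) -/
def OPlusAll : Prop := ∀ a b : ℕ, OPlus a b

/-- The one-block potential `q_b(c) = (b − 1) + 2^b·[c = 0]` on `𝔽₂^b`. (p1 §6g, verbatim) -/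
def qpot (b : ℕ) : (Fin b → ZMod 2) → ℚ := fun c => ((b : ℚ) - 1) + if c = 0 then (2 : ℚ) ^ b else 0

/-- (i) of §6g: the one-block potential is dominating, for every block size. (p1 §6g, verbatim; proved in
`ClusUniversalCertificateOPlusImpliesUC`) -/
def QPotDom : Prop := ∀ b : ℕ, IsDomPot b (qpot b)

/-- (ii) of §6g, the support theorem: (⊕) implies the mixed certificate in every total dimension. (p1 §6g, verbatim;
proved in `ClusUniversalCertificateOPlusImpliesUC`) -/
def OPlusImpliesUC : Prop := OPlusAll → ∀ M : ℕ, UCMixDim M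

/-- The `b = 1` case of (⊕) = the LIFTING LEMMA (strong SC₁); `Lift1 a` for `a ≤ 3` are the first-rung candidates.
(p1 §6g, verbatim) -/
def Lift1 (a : ℕ) : Prop := OPlus a 1

/-- Prover's helper object: the BLOCK POTENTIAL of a block map `blk : Fin M → Fin n`,
`bpot blk y = Σ_j ((bsize j − 1) + 2^{bsize j}·[block j of y vanishes])` — the direct sum of the `qpot (bsize j)`
along the blocks; `UCMix M n blk Y` is literally `dsum Y ≤ Σ_{y∈Y} bpot blk y`
(`ClusCoordOPlus.ucMix_iff_dsum_le_bpot` in the companion file). -/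
def bpot {M n : ℕ} (blk : Fin M → Fin n) (y : Fin M → ZMod 2) : ℚ :=
  ∑ j : Fin n, ((((bsize blk j : ℕ) : ℚ) - 1) + if (∀ i, blk i = j → y i = 0) then (2 : ℚ) ^ (bsize blk j) else 0)

end Summit.PneNP.PneNP.Theorems.ClusCoordOPlus
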